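import Summits.NavierStokesRegularity.FluidComputer.PalasekTowerPerturbedRunTools

/-!
# THE PERTURBED RUN, II: a bounded classical FREE Navier–Stokes run on a closed slab is shadowed, on
# the whole slab, by a classical run of the system FORCED by any Clay-class force of small `L²` size

Cell `ns-blowup`, seat `ns-blowup-ecbridge-3` (g6; D-0074 GROUP C «BRIDGE SUPPORT», lineage
`host_preparation`; bears_on LADDER-NS N1, route `PalasekTowerBreakdown`, crux `EpisodeBase` = item
stmt-NavierStokesRegularity-19179, line `slot` v5, stub `stub_explicit_slice_run : ExplicitSliceRun`).
LABEL: E–C typing + kernel analysis (theorems only; no definition, no named fact, no `sorry`).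
WHAT THIS IS NOT: not Navier–Stokes evidence — an EXISTENCE-AND-CLOSENESS theorem for the forced system
next to a GIVEN free classical run on a FIXED slab; no stage, host, episode or blow-up is constructed
or asserted.

## The theorem (`PerturbedRun.exists_forced_run_near_free_run`)

Let `ν > 0`, `T > 0`, and let `(u, p)` be a classical solution of the UNFORCED Navier–Stokes system on
`[0, T] × ℝ³` with finite energy, `‖u‖ ≤ M` and a Schwartz datum `u 0`. Let `f` be a Clay-class force
(smooth on `[0, ∞) × ℝ³` with Fefferman's space-time decay) with `‖f(t)‖₂ ≤ G₂` on `[0, T]`, so small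
that the stability bound of `ClassicalSupStabilityBootstrap` at `M' = M + 1` is `≤ 1/2`:
`2 · (4 ν^{-3/4} T^{1/4} G₂) · exp (36 C₀² (2M+1)² T / ν) ≤ 1/2`. Then the FORCED system has a classical
finite-energy solution `(u', p')` on the whole slab `[0, T] × ℝ³` from the same datum, with
`‖u'(t,x) − u(t,x)‖ ≤ 2 (4 ν^{-3/4} T^{1/4} G₂) exp (36 C₀² (2M+1)² t / ν) (≤ 1/2)` everywhere.

## The argument (maximal classical solution; every input a theorem of the tree, part I)

Let `s⋆` be the supremum of the times `s ∈ (0, T]` for which a classical finite-energy forced run from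
`u 0` exists on `[0, s]` (nonempty by `exists_local_forcedRun`). Runs on different slabs agree
(`forcedRun_unique`), so the runs below `s⋆` glue to a classical solution on `[0, s⋆)` (normalised
pressures, `pressure_sub_apply_zero_eq_of_eqOn_Icc`, `isClassicalNSSolutionOn_Ico_of_forall_Icc`) whose
velocity is bounded by `M + 1/2` (`forcedRun_near`) and whose energy is bounded by Tao's forced energy
inequality (`tao2011_forced_finiteEnergy_energyBound_holds`); it therefore extends classically PAST `s⋆`
(`ForcedContinuation.exists_extension_of_bounded_Ico`). Hence `s⋆ = T` is attained, and the run on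
`[0, T]` is within the stated distance of `u` (`forcedRun_near`).

References: T. Tao, Anal. PDE 6 (2013), Thm. 5.4, Lemma 8.1, Cor. 11.1 [cite: Tao2011, Thm. 5.4 (ii)+(iv)];
P. G. Lemarié-Rieusset, *The Navier–Stokes Problem in the 21st Century* (2016), Thm. 11.2 (11.11)
[cite: LemarieRieusset2016, Thm. 11.2 (11.11)]; J. Leray, Acta Math. 63 (1934) §19 [cite: Leray1934, §19 (3.4)–(3.8)];
J. C. Robinson, J. L. Rodrigo, W. Sadowski (2016), Thm. 8.17 (restart–identify–glue)
[cite: RobinsonRodrigoSadowski2016, Thm. 8.17]; S. Palasek, arXiv:2605.13827 §4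
[cite: Palasek2026ElementaryModel, §4].
-/

noncomputable section

namespace Summit.NavierStokesRegularity.FluidComputer.PalasekTowerClayBridge.PerturbedRun

open Set MeasureTheory Filter Topology Function Real
open scoped ENNReal NNReal ContDiff
open Literature.Analysis.FluidPDE

section Main

variable {ν T M G₂r : ℝ} {f u : ℝ → EuclideanSpace ℝ (Fin 3) → EuclideanSpace ℝ (Fin 3)}
  {p : ℝ → EuclideanSpace ℝ (Fin 3) → ℝ}

/-- **THE PERTURBED RUN.** Let `ν > 0`, `T > 0`; let `(u, p)` be a classical solution of the UNFORCED
Navier–Stokes system on `[0, T] × ℝ³` with finite energy, `‖u‖ ≤ M` (`M > 0`) and a Schwartz datum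
`u 0`; let `f` be a Clay-class force with `‖f(t)‖₂ ≤ G₂` on `[0, T]` (`G₂ ≥ 0`) and
`2 (0 + 4 ν^{-3/4} T^{1/4} G₂) exp (36 C₀² (M + (M+1))² T / ν) ≤ 1/2`. Then the system FORCED by `f`
has a classical finite-energy solution `(u', p')` on `[0, T] × ℝ³` with `u' 0 = u 0` and
`‖u'(t,x) − u(t,x)‖ ≤ 2 (0 + 4 ν^{-3/4} T^{1/4} G₂) exp (36 C₀² (M + (M+1))² t / ν)` for all
`t ∈ [0, T]`, `x`. [cite: Tao2011, Thm. 5.4 (ii)+(iv)] [cite: LemarieRieusset2016, Thm. 11.2 (11.11)]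
[cite: Leray1934, §19 (3.4)–(3.8)] -/
theorem exists_forced_run_near_free_run (hν : 0 < ν) (hT : 0 < T)
    (hs : IsSmoothOnHalfSpace f) (hd : HasRapidSpaceTimeDecay f)
    (hu : IsClassicalNSSolutionOn (Icc 0 T) ν 0 u p)
    (hE : ∃ C : ℝ≥0∞, C < ⊤ ∧ ∀ t ∈ Icc 0 T, ∫⁻ x, ‖u t x‖ₑ ^ 2 ≤ C)
    (hM : 0 < M) (hbd : ∀ t ∈ Icc 0 T, ∀ x, ‖u t x‖ ≤ M) (h0 : HasRapidSpatialDecay (u 0))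
    (hG₂r : 0 ≤ G₂r) (hfL2 : ∀ t ∈ Icc 0 T, eLpNorm (f t) 2 volume ≤ ENNReal.ofReal G₂r)
    (hΦ : 2 * (0 + 4 * ν ^ (-(3 / 4 : ℝ)) * T ^ (1 / 4 : ℝ) * G₂r) *
      Real.exp (36 * oseenSliceConst (EuclideanSpace ℝ (Fin 3)) ^ 2 * (M + (M + 1)) ^ 2 / ν * T) ≤
        1 / 2) :
    ∃ (u' : ℝ → EuclideanSpace ℝ (Fin 3) → EuclideanSpace ℝ (Fin 3))
      (p' : ℝ → EuclideanSpace ℝ (Fin 3) → ℝ),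
      IsClassicalNSSolutionOn (Icc 0 T) ν f u' p' ∧ u' 0 = u 0 ∧
      (∃ C : ℝ≥0∞, C < ⊤ ∧ ∀ t ∈ Icc 0 T, ∫⁻ x, ‖u' t x‖ₑ ^ 2 ≤ C) ∧
      ∀ t ∈ Icc 0 T, ∀ x, ‖u' t x - u t x‖ ≤
        2 * (0 + 4 * ν ^ (-(3 / 4 : ℝ)) * T ^ (1 / 4 : ℝ) * G₂r) *
          Real.exp (36 * oseenSliceConst (EuclideanSpace ℝ (Fin 3)) ^ 2 * (M + (M + 1)) ^ 2 / ν * t) := by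
  classical
  set a : EuclideanSpace ℝ (Fin 3) → EuclideanSpace ℝ (Fin 3) := u 0 with ha_def
  have h0T : (0 : ℝ) ∈ Icc 0 T := ⟨le_rfl, hT.le⟩
  -- the three tools of part I, specialised to the present data
  have bound := fun {s : ℝ} (hs0 : 0 < s) (hsT : s ≤ T)
      {u' : ℝ → EuclideanSpace ℝ (Fin 3) → EuclideanSpace ℝ (Fin 3)}
      {p' : ℝ → EuclideanSpace ℝ (Fin 3) → ℝ}
      (hcl' : IsClassicalNSSolutionOn (Icc 0 s) ν f u' p') (hu'0 : u' 0 = a)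
      (hE' : ∃ C : ℝ≥0∞, C < ⊤ ∧ ∀ t ∈ Icc 0 s, ∫⁻ x, ‖u' t x‖ₑ ^ 2 ≤ C) =>
    forcedRun_near hν hT hs hd hu hE hM hbd h0 hG₂r hfL2 hΦ hs0 hsT hcl' hu'0 hE'
  have uniq := fun {s s' : ℝ} (hs0 : 0 < s) (hss' : s ≤ s') (hs'T : s' ≤ T)
      {u₁ u₂ : ℝ → EuclideanSpace ℝ (Fin 3) → EuclideanSpace ℝ (Fin 3)}
      {p₁ p₂ : ℝ → EuclideanSpace ℝ (Fin 3) → ℝ}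
      (h₁ : IsClassicalNSSolutionOn (Icc 0 s) ν f u₁ p₁) (h₁0 : u₁ 0 = a)
      (hE₁ : ∃ C : ℝ≥0∞, C < ⊤ ∧ ∀ t ∈ Icc 0 s, ∫⁻ x, ‖u₁ t x‖ₑ ^ 2 ≤ C)
      (h₂ : IsClassicalNSSolutionOn (Icc 0 s') ν f u₂ p₂) (h₂0 : u₂ 0 = a)
      (hE₂ : ∃ C : ℝ≥0∞, C < ⊤ ∧ ∀ t ∈ Icc 0 s', ∫⁻ x, ‖u₂ t x‖ₑ ^ 2 ≤ C) =>
    forcedRun_unique hν hT hs hd hu hE hM hbd h0 hG₂r hfL2 hΦ hs0 hss' hs'T h₁ h₁0 hE₁ h₂ h₂0 hE₂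
  -- ### force bookkeeping: `∫_{[0,s]} ‖f(t)‖₂ dt ≤ ∫_{[0,T]} ‖f(t)‖₂ dt < ∞`
  obtain ⟨Cf₀, Cf₁, Bf, -, hCf₀, -, -⟩ := ForcedContinuation.exists_force_slice_bounds hs hd
  have hfE : ∀ s : ℝ, s ≤ T →
      ∫⁻ t in Icc 0 s, (∫⁻ x, ‖f t x‖ₑ ^ 2) ^ (1 / 2 : ℝ) ≤
        ∫⁻ t in Icc 0 T, (∫⁻ x, ‖f t x‖ₑ ^ 2) ^ (1 / 2 : ℝ) :=
    fun s hsT => lintegral_mono_set (Icc_subset_Icc le_rfl hsT)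
  have hfET : ∫⁻ t in Icc 0 T, (∫⁻ x, ‖f t x‖ₑ ^ 2) ^ (1 / 2 : ℝ) < ⊤ := by
    calc ∫⁻ t in Icc 0 T, (∫⁻ x, ‖f t x‖ₑ ^ 2) ^ (1 / 2 : ℝ)
        ≤ ∫⁻ _t in Icc 0 T, (Cf₀ : ℝ≥0∞) ^ (1 / 2 : ℝ) :=
          setLIntegral_mono' measurableSet_Icc fun t ht =>
            ENNReal.rpow_le_rpow (hCf₀ t ht.1) (by norm_num)
      _ = (Cf₀ : ℝ≥0∞) ^ (1 / 2 : ℝ) * volume (Icc (0 : ℝ) T) := setLIntegral_const _ _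
      _ < ⊤ := by
          rw [Real.volume_Icc]
          exact ENNReal.mul_lt_top (ENNReal.rpow_lt_top_of_nonneg (by norm_num) ENNReal.coe_ne_top)
            ENNReal.ofReal_lt_top
  have ha_L2 : ∫⁻ x, ‖a x‖ₑ ^ 2 < ⊤ := by
    obtain ⟨C, hC, hb⟩ := hE
    exact lt_of_le_of_lt (hb 0 h0T) hC
  -- ### the set of existence times and its supremum
  set 𝒮 : Set ℝ := {s | 0 < s ∧ s ≤ T ∧
      ∃ (u' : ℝ → EuclideanSpace ℝ (Fin 3) → EuclideanSpace ℝ (Fin 3))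
        (p' : ℝ → EuclideanSpace ℝ (Fin 3) → ℝ),
        IsClassicalNSSolutionOn (Icc 0 s) ν f u' p' ∧ u' 0 = a ∧
        (∃ C : ℝ≥0∞, C < ⊤ ∧ ∀ t ∈ Icc 0 s, ∫⁻ x, ‖u' t x‖ₑ ^ 2 ≤ C)} with h𝒮
  obtain ⟨s₁, hs₁pos, hs₁T, u₁, p₁, hu₁, hu₁0, hE₁⟩ :=
    exists_local_forcedRun (f := f) hν hT hs hd (hu.contDiff_velocity h0T) (hu.divFree 0 h0T) h0
  have hs₁mem : s₁ ∈ 𝒮 := ⟨hs₁pos, hs₁T, u₁, p₁, hu₁, hu₁0, hE₁⟩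
  have h𝒮ne : 𝒮.Nonempty := ⟨s₁, hs₁mem⟩
  have h𝒮bdd : BddAbove 𝒮 := ⟨T, fun s hs => hs.2.1⟩
  set sStar : ℝ := sSup 𝒮 with hsStar
  have hs₁le : s₁ ≤ sStar := le_csSup h𝒮bdd hs₁mem
  have hsStarpos : 0 < sStar := lt_of_lt_of_le hs₁pos hs₁le
  have hsStarT : sStar ≤ T := csSup_le h𝒮ne fun s hs => hs.2.1
  -- every `s < s⋆` is an existence time (restriction of a later run)
  have hrun : ∀ s ∈ Ioo 0 sStar,
      ∃ (u' : ℝ → EuclideanSpace ℝ (Fin 3) → EuclideanSpace ℝ (Fin 3))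
        (p' : ℝ → EuclideanSpace ℝ (Fin 3) → ℝ),
        IsClassicalNSSolutionOn (Icc 0 s) ν f u' p' ∧ u' 0 = a ∧
        (∃ C : ℝ≥0∞, C < ⊤ ∧ ∀ t ∈ Icc 0 s, ∫⁻ x, ‖u' t x‖ₑ ^ 2 ≤ C) := by
    intro s hs
    obtain ⟨s', hs'mem, hss'⟩ := exists_lt_of_lt_csSup h𝒮ne hs.2
    obtain ⟨-, -, u', p', hu', hu'0, hE'⟩ := hs'mem
    have hsub : Icc 0 s ⊆ Icc 0 s' := Icc_subset_Icc le_rfl hss'.le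
    refine ⟨u', p', hu'.mono hsub (uniqueDiffOn_Icc hs.1), hu'0, ?_⟩
    obtain ⟨C, hC, hb⟩ := hE'
    exact ⟨C, hC, fun t ht => hb t (hsub ht)⟩
  -- ### the coherent union on `[0, s⋆)`
  -- a run reaching past `t`, for each `t ∈ [0, s⋆)`: on `[0, σ t]`, `σ t = (t + s⋆)/2`
  have hσ : ∀ t ∈ Ico 0 sStar, (t + sStar) / 2 ∈ Ioo 0 sStar ∧ t < (t + sStar) / 2 := fun t ht =>
    ⟨⟨by linarith [ht.1], by linarith [ht.2]⟩, by linarith [ht.2]⟩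
  have hchoice : ∀ t : ℝ, ∃ (u' : ℝ → EuclideanSpace ℝ (Fin 3) → EuclideanSpace ℝ (Fin 3))
      (p' : ℝ → EuclideanSpace ℝ (Fin 3) → ℝ), t ∈ Ico 0 sStar →
        IsClassicalNSSolutionOn (Icc 0 ((t + sStar) / 2)) ν f u' p' ∧ u' 0 = a ∧
        (∃ C : ℝ≥0∞, C < ⊤ ∧ ∀ τ ∈ Icc 0 ((t + sStar) / 2), ∫⁻ x, ‖u' τ x‖ₑ ^ 2 ≤ C) := by
    intro t
    by_cases ht : t ∈ Ico 0 sStar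
    · obtain ⟨u', p', h⟩ := hrun _ (hσ t ht).1
      exact ⟨u', p', fun _ => h⟩
    · exact ⟨fun _ _ => 0, fun _ _ => 0, fun h => absurd h ht⟩
  choose Uf Pf hUP using hchoice
  -- the union: velocity and normalised pressure
  set Us : ℝ → EuclideanSpace ℝ (Fin 3) → EuclideanSpace ℝ (Fin 3) := fun t => Uf t t with hUs
  set Ps : ℝ → EuclideanSpace ℝ (Fin 3) → ℝ := fun t x => Pf t t x - Pf t t 0 with hPs
  -- agreement with the run chosen at `t₀`, below `σ t₀`
  have hagree : ∀ t₀ ∈ Ico 0 sStar, ∀ t ∈ Ico 0 ((t₀ + sStar) / 2),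
      Us t = Uf t₀ t ∧ ∀ x, Ps t x = Pf t₀ t x - Pf t₀ t 0 := by
    intro t₀ ht₀ t ht
    obtain ⟨hσ₀, -⟩ := hσ t₀ ht₀
    have htS : t ∈ Ico 0 sStar := ⟨ht.1, ht.2.trans hσ₀.2⟩
    obtain ⟨hσt, htσt⟩ := hσ t htS
    obtain ⟨hcl₀, h0₀, hE₀⟩ := hUP t₀ ht₀
    obtain ⟨hclt, h0t, hEt⟩ := hUP t htS
    -- the common slab `[0, m]`, `m = min (σ t) (σ t₀) > t`
    set m : ℝ := min ((t + sStar) / 2) ((t₀ + sStar) / 2) with hm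
    have htm : t < m := lt_min htσt ht.2
    have hm₁ : m ≤ (t + sStar) / 2 := min_le_left _ _
    have hm₂ : m ≤ (t₀ + sStar) / 2 := min_le_right _ _
    have heq : ∀ τ ∈ Icc 0 m, Uf t τ = Uf t₀ τ := by
      rcases le_total ((t + sStar) / 2) ((t₀ + sStar) / 2) with hle | hle
      · have hmeq : m = (t + sStar) / 2 := min_eq_left hle
        intro τ hτ
        rw [hmeq] at hτ
        exact (uniq hσt.1 hle (hσ₀.2.le.trans hsStarT) hclt h0t hEt hcl₀ h0₀ hE₀ τ hτ).symm
      · have hmeq : m = (t₀ + sStar) / 2 := min_eq_right hle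
        intro τ hτ
        rw [hmeq] at hτ
        exact uniq hσ₀.1 hle (hσt.2.le.trans hsStarT) hcl₀ h0₀ hE₀ hclt h0t hEt τ hτ
    refine ⟨heq t ⟨ht.1, htm.le⟩, fun x => ?_⟩
    exact pressure_sub_apply_zero_eq_of_eqOn_Icc hclt hcl₀ hm₁ hm₂ heq ⟨ht.1, htm⟩ x
  -- the union is classical on every closed sub-slab `[0, τ₁]`, `τ₁ < s⋆`
  have hIcc : ∀ τ₁ ∈ Ioo 0 sStar, IsClassicalNSSolutionOn (Icc 0 τ₁) ν f Us Ps := by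
    intro τ₁ hτ₁
    have hτ₁' : τ₁ ∈ Ico 0 sStar := ⟨hτ₁.1.le, hτ₁.2⟩
    obtain ⟨-, hτσ₁⟩ := hσ τ₁ hτ₁'
    obtain ⟨hcl₁, -, -⟩ := hUP τ₁ hτ₁'
    have hsub : Icc 0 τ₁ ⊆ Icc 0 ((τ₁ + sStar) / 2) := Icc_subset_Icc le_rfl hτσ₁.le
    have h1 : IsClassicalNSSolutionOn (Icc 0 τ₁) ν f (Uf τ₁) (fun t x => Pf τ₁ t x - Pf τ₁ t 0) :=
      (normalise_pressure hcl₁).mono hsub (uniqueDiffOn_Icc hτ₁.1)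
    have hmemσ : ∀ t ∈ Icc 0 τ₁, t ∈ Ico 0 ((τ₁ + sStar) / 2) := fun t ht =>
      ⟨ht.1, lt_of_le_of_lt ht.2 hτσ₁⟩
    exact congr_pressure' (h1.congr_velocity fun t ht => (hagree τ₁ hτ₁' t (hmemσ t ht)).1)
      fun t ht => funext fun x => ((hagree τ₁ hτ₁' t (hmemσ t ht)).2 x)
  have hIco : IsClassicalNSSolutionOn (Ico 0 sStar) ν f Us Ps :=
    isClassicalNSSolutionOn_Ico_of_forall_Icc hsStarpos hIcc
  -- datum, velocity bound and energy bound on `[0, s⋆)`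
  have hUs0 : Us 0 = a := by
    obtain ⟨-, h00, -⟩ := hUP 0 ⟨le_rfl, hsStarpos⟩
    exact h00
  have hUsM : ∀ t ∈ Ico 0 sStar, ∀ x, ‖Us t x‖ ≤ M + 1 / 2 := by
    intro t ht x
    obtain ⟨hσt, htσt⟩ := hσ t ht
    obtain ⟨hclt, h0t, hEt⟩ := hUP t ht
    exact (bound hσt.1 (hσt.2.le.trans hsStarT) hclt h0t hEt t ⟨ht.1, htσt.le⟩ x).2.2
  obtain ⟨CE, hCEtop, hEn⟩ := tao2011_forced_finiteEnergy_energyBound_holds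
  set Ebd : ℝ≥0∞ := CE * ((∫⁻ x, ‖a x‖ₑ ^ 2) ^ (1 / 2 : ℝ) +
    ∫⁻ t in Icc 0 T, (∫⁻ x, ‖f t x‖ₑ ^ 2) ^ (1 / 2 : ℝ)) ^ 2 with hEbd
  have hEbdtop : Ebd < ⊤ := by
    refine ENNReal.mul_lt_top hCEtop (ENNReal.pow_lt_top (ENNReal.add_lt_top.2 ⟨?_, hfET⟩))
    exact ENNReal.rpow_lt_top_of_nonneg (by norm_num) ha_L2.ne
  have hUsE : ∃ C : ℝ≥0∞, C < ⊤ ∧ ∀ t ∈ Ico 0 sStar, ∫⁻ x, ‖Us t x‖ₑ ^ 2 ≤ C := by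
    refine ⟨Ebd, hEbdtop, fun t ht => ?_⟩
    obtain ⟨hσt, htσt⟩ := hσ t ht
    obtain ⟨hclt, h0t, hEt⟩ := hUP t ht
    have hEA : ∃ A : ℝ≥0, ∀ τ ∈ Icc 0 ((t + sStar) / 2), ∫⁻ x, ‖Uf t τ x‖ₑ ^ 2 ≤ A := by
      obtain ⟨C, hC, hb⟩ := hEt
      exact ⟨C.toNNReal, fun τ hτ => (hb τ hτ).trans (ENNReal.coe_toNNReal hC.ne).ge⟩
    have hfEσ : ∫⁻ τ in Icc 0 ((t + sStar) / 2), (∫⁻ x, ‖f τ x‖ₑ ^ 2) ^ (1 / 2 : ℝ) < ⊤ :=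
      lt_of_le_of_lt (hfE _ (hσt.2.le.trans hsStarT)) hfET
    have h1 := (hEn hν hσt.1 hclt (hs.isSmoothSpaceTimeOn_Icc _) hfEσ hEA).1 t ⟨ht.1, htσt.le⟩
    rw [h0t] at h1
    refine h1.trans ?_
    rw [hEbd]
    gcongr
    exact hσt.2.le.trans hsStarT
  have hUs0' : HasRapidSpatialDecay (Us 0) := by rw [hUs0]; exact h0
  -- ### extension past `s⋆`: hence `s⋆ = T` and `T` is an existence time
  obtain ⟨T'', hT'', U, P, hU, hUeq, hUE⟩ :=
    ForcedContinuation.exists_extension_of_bounded_Ico hν hsStarpos hs hd hIco hUsE hUsM hUs0'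
  have hU0 : U 0 = a := by rw [hUeq 0 ⟨le_rfl, hsStarpos⟩, hUs0]
  set T₁ : ℝ := min T'' T with hT₁
  have hT₁pos : 0 < T₁ := lt_min (hsStarpos.trans hT'') hT
  have hT₁T : T₁ ≤ T := min_le_right _ _
  have hT₁mem : T₁ ∈ 𝒮 := by
    have hsub : Icc 0 T₁ ⊆ Icc 0 T'' := Icc_subset_Icc le_rfl (min_le_left _ _)
    refine ⟨hT₁pos, hT₁T, U, P, hU.mono hsub (uniqueDiffOn_Icc hT₁pos), hU0, ?_⟩
    obtain ⟨C, hC, hb⟩ := hUE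
    exact ⟨C, hC, fun t ht => hb t (hsub ht)⟩
  have hT₁le : T₁ ≤ sStar := le_csSup h𝒮bdd hT₁mem
  have hT₁eq : T₁ = T := by
    rcases le_total T'' T with h | h
    · exfalso
      have : T₁ = T'' := min_eq_left h
      linarith
    · exact min_eq_right h
  -- ### the run on `[0, T]` and its closeness to `u`
  rw [hT₁eq] at hT₁mem
  obtain ⟨-, -, u', p', hcl', hu'0, hE'⟩ := hT₁mem
  exact ⟨u', p', hcl', hu'0, hE', fun t ht x => (bound hT le_rfl hcl' hu'0 hE' t ht x).1⟩

end Main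

end Summit.NavierStokesRegularity.FluidComputer.PalasekTowerClayBridge.PerturbedRun

end
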